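import Literature.Barriers.CriticalPhenomena.PlaquetteWalkHoleRootNoKissSeven
import Literature.Barriers.CriticalPhenomena.PlaquetteWalkHoleRootRowLaw
import HarnessLib

/-!
# Barrier catalogue (SAWScalingLimit): the cost-`7` vertical-end parents above the root row return to their TOP ROW («COLUMN LAW», first step)

`Z → ∞` limit model of the printed Yang–Baxter weights [GlazmanManolescu2019, §1, eq. (1)]; the «RECTANGLE COEFFICIENT» line of the venture lane «pcv-sawmu»
(b-engine-1 g26), first step of (T2) in the COLUMN LAW programme (FINDING-YB-LEVEL5-PHASE-LAW §3–§4: at the cells above the root plaquette the cost-`5`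
wound members are class-`B2b` extensions with slot `N`). ★★★ `ΩG.top_row_of_cost_seven_vert_above`: a wound class-`B2a` walk of limit cost `7` from the
hole root `w.side W` (hole absent), returning to a VERTICAL side of a rhombus `r` STRICTLY ABOVE the root row with a TURNING first arc in `r`, has `r` in
its topmost row; hence (★★ `ΩG.usesSide_S_of_cost_seven_vert_above`) its first arc in `r` uses the `S` side of `r`, never `N` — the free fourth side of `r`
is `N`, which is the slot of the class-`B2b` member it fathers. Proof by the CHAIN CALCULUS of `PlaquetteWalkKissChains`: the six isolated turns
(`n_{u₁} + n_{u₂} = 6`) are the two top-row turns, the two bottom-row turns, `r`, and the root-row turn at the east end of the first turn's chain; if `r`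
were strictly below the top row, the horizontal chain of `r` along its row would end at a seventh.
[GlazmanManolescu2019 §1 Fig. 1, eq. (1), Lemma 2.1, Remark 2.2; Glazman2015WeightedSAW Lemma 3.1 (proof, pp. 6–7); CourantRobbins1958 Ch. V App. §2]
-/

noncomputable section

namespace Literature.Probability.RandomPlanarGeometry.SAW.YangBaxter

open Real
open Literature.Barriers.CriticalPhenomena.PlaquetteWalk

open private fc_fh fh_add_Mv three_le_Mv from Literature.Probability.RandomPlanarGeometry.YangBaxterSAWGeneralDomain

namespace ΩG

variable {D : Set Face} {w r : Face} {ω : ΩG D (w.side .W) r}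

/-- ★★★ **THE COST-`7` VERTICAL-END PARENTS ABOVE THE ROOT ROW RETURN TO THEIR TOP ROW.** A wound class-`B2a` walk of limit cost `7` from the hole root
`w.side W` (hole absent) at a rhombus `r` with `w.2 < r.2`, returning to a vertical side of `r` (`ω.1 ∈ {E, W}`) with a turning first arc in `r`, has all
its plaquettes in rows `≤ r.2`. [cite: GlazmanManolescu2019, §1, Fig. 1 and eq. (1); Lemma 2.1; Remark 2.2] [cite: Glazman2015WeightedSAW, Lemma 3.1 (proof, pp. 6–7)]
[cite: CourantRobbins1958, Ch. V Appendix §2 (the even–odd rule)] -/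
theorem top_row_of_cost_seven_vert_above (hh : holeFaceW w ∉ D) (hr : RootedFace D (w.side .W) r) (h : ω.IsB2a)
    (hA : ω.AJ hr h (toC (midPt (w.side .W))) ≠ 0) (hc : cost (slotOfSide ω.1) ω.2.mids = 7) (hz : ω.1 = .E ∨ ω.1 = .W)
    (hNS : arcKind (ω.2.sIn ω.2.firstHitG) (ω.2.sOut ω.2.firstHitG) ≠ .straight) (habove : w.2 < r.2) :
    ∀ j < ω.2.arcs.length, (ω.2.fc j).2 ≤ r.2 := by
  classical
  set n := ω.2.arcs.length with hn
  -- counts: six isolated turns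
  have hd : slotDeg (slotOfSide ω.1) = 0 := by rcases hz with e | e <;> rw [e] <;> rfl
  have h6 : cfgCount ω.2.mids [.corner] + cfgCount ω.2.mids [.coCorner] = 6 := by
    have hcost : cost (slotOfSide ω.1) ω.2.mids =
        cfgCount ω.2.mids [.corner] + cfgCount ω.2.mids [.coCorner] + (1 - slotDeg (slotOfSide ω.1)) := rfl
    rw [hcost, hd] at hc; omega
  let P : Face → Prop := fun f => f ∈ facesL ω.2.mids ∧ (kindsL ω.2.mids f = [.corner] ∨ kindsL ω.2.mids f = [.coCorner])
  have hPiso : ∀ k < n, (∀ l < n, ω.2.fc l = ω.2.fc k → l = k) → arcKind (ω.2.sIn k) (ω.2.sOut k) ≠ .straight → P (ω.2.fc k) :=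
    fun k hk hsv hkind => isolated_turn hk hsv hkind
  have hle6 : ∀ T : Finset Face, (∀ f ∈ T, P f) → T.card ≤ 6 := by
    intro T hT; have := YBWalk.card_le_cfgCount_add ω.2.mids T hT; omega
  -- the first arc, the last arc, the rooted rhombus
  have hF := ω.fh_lt h
  have hlen : 0 < n := by omega
  have h0w : ω.2.fc 0 = w := fc_zero_eq_root w hh ω.2 hlen
  have h0W : ω.2.sIn 0 = .W := YBWalk.sIn_zero_eq_W hh ω.2 hlen
  have h0E : ω.2.sIn 0 ≠ .E := by rw [h0W]; decide
  have hlast := last_of_vertical_end hr h hz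
  have hfne3 : ω.2.firstHitG + 3 ≤ n := by have := three_le_Mv hr h; have := fh_add_Mv h; unfold ΩG.Mv at *; omega
  have hfcF := (fc_fh ω hr h).1
  have hsvr : ∀ l < n, ω.2.fc l = ω.2.fc ω.2.firstHitG → l = ω.2.firstHitG := fun l hl e => eq_firstHitG_of_fc_eq hr h hl e
  have hPr : P r := by rw [← hfcF]; exact hPiso _ hF hsvr hNS
  have hrside : ∀ s, ω.2.UsesSide r s → r.side s ≠ r.side ω.1 := by
    rintro s ⟨l, hl, hfl, hs⟩ e
    have hl' := hsvr l hl (hfl.trans hfcF.symm)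
    obtain ⟨hin, hout⟩ := ω.2.side_sIn_eq_nth hl
    rw [hfl] at hin hout
    rw [← ω.2.nth_length] at e
    rcases hs with hs | hs
    · rw [hs] at hin; have := ω.2.nth_inj (show l ≤ n by omega) le_rfl (hin.symm.trans e).symm.symm; omega
    · rw [hs] at hout; have := ω.2.nth_inj (show l + 1 ≤ n by omega) le_rfl (hout.symm.trans e).symm.symm; omega
  have hneF := ω.2.sIn_ne_sOut hF
  have hrEW : ω.2.UsesSide r .E ∨ ω.2.UsesSide r .W := by
    have key : (ω.2.sIn ω.2.firstHitG = .E ∨ ω.2.sOut ω.2.firstHitG = .E) ∨ (ω.2.sIn ω.2.firstHitG = .W ∨ ω.2.sOut ω.2.firstHitG = .W) := by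
      revert hNS hneF; cases ω.2.sIn ω.2.firstHitG <;> cases ω.2.sOut ω.2.firstHitG <;> decide
    rcases key with hE | hW
    · exact Or.inl ⟨_, hF, hfcF, hE⟩
    · exact Or.inr ⟨_, hF, hfcF, hW⟩
  obtain ⟨X, -, hX, -⟩ := exists_left_entry_turn hh hr h hA
  obtain ⟨X', -, hX', -⟩ := exists_right_entry_turn hh hr h
  ---------------------------------------------------------------- the top row: if `r` lies on it we are done
  obtain ⟨Y, hYw, hY, i₀, i₁, -, hi₀2, hrow₀, hS₀, hWE₀, -, hi₁, hrow₁, -, halt⟩ := top_exit_or_end hh hr h hA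
  by_cases hYr : Y = r.2
  · intro j hj; rw [← hYr]; exact hY j hj
  exfalso
  have hrY : r.2 < Y := by have := hY _ hF; rw [hfcF] at this; omega
  obtain ⟨hS₁, hWE₁, -, hfne⟩ : (ω.2.sOut i₁ = .S ∧ (ω.2.sIn i₁ = .W ∨ ω.2.sIn i₁ = .E) ∧ i₀ ≠ i₁ ∧ ω.2.fc i₀ ≠ ω.2.fc i₁) := by
    rcases halt with hh' | ⟨-, -, hrY'⟩
    · exact hh'
    · exfalso; omega
  obtain ⟨Y', hY'w, hY', j₀, j₁, -, hj₀2, hrow₀', hN₀', hWE₀', -, hj₁, hrow₁', -, halt'⟩ := bottom_exit_or_end hh hr h hA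
  obtain ⟨hN₁', hWE₁', -, hfne'⟩ : (ω.2.sOut j₁ = .N ∧ (ω.2.sIn j₁ = .W ∨ ω.2.sIn j₁ = .E) ∧ j₀ ≠ j₁ ∧ ω.2.fc j₀ ≠ ω.2.fc j₁) := by
    rcases halt' with hh' | ⟨-, -, hrY'⟩
    · exact hh'
    · exfalso; omega
  have hi₀ : i₀ < n := by omega
  have hj₀ : j₀ < n := by omega
  have hsvT : ∀ k, k < n → (ω.2.fc k).2 = Y → ∀ l < n, ω.2.fc l = ω.2.fc k → l = k :=
    fun k hk hrw l hl e => (top_single_visit hh hr h hY (by omega) hk hl hrw e.symm).symm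
  have hsvB : ∀ k, k < n → (ω.2.fc k).2 = Y' → ∀ l < n, ω.2.fc l = ω.2.fc k → l = k :=
    fun k hk hrw l hl e => (bottom_single_visit hh hr h hY' (by omega) hk hl hrw e.symm).symm
  have hPt₀ : P (ω.2.fc i₀) := hPiso i₀ hi₀ (hsvT i₀ hi₀ hrow₀) (by rw [hS₀]; exact YBWalk.arcKind_ne_straight_of_S_WE (Or.inl rfl) hWE₀)
  have hPt₁ : P (ω.2.fc i₁) := hPiso i₁ hi₁ (hsvT i₁ hi₁ hrow₁) (by rw [hS₁]; exact YBWalk.arcKind_ne_straight_of_WE_S hWE₁ (Or.inl rfl))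
  have hPb₀ : P (ω.2.fc j₀) := hPiso j₀ hj₀ (hsvB j₀ hj₀ hrow₀') (by rw [hN₀']; exact YBWalk.arcKind_ne_straight_of_S_WE (Or.inr rfl) hWE₀')
  have hPb₁ : P (ω.2.fc j₁) := hPiso j₁ hj₁ (hsvB j₁ hj₁ hrow₁') (by rw [hN₁']; exact YBWalk.arcKind_ne_straight_of_WE_S hWE₁' (Or.inr rfl))
  ---------------------------------------------------------------- the root-row turn `τ` at the east end of the first turn's chain
  have hk₁ex : ∃ k, arcKind (ω.2.sIn k) (ω.2.sOut k) ≠ .straight := ⟨_, hNS⟩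
  set k₁ := Nat.find hk₁ex with hk₁def
  have hturn : arcKind (ω.2.sIn k₁) (ω.2.sOut k₁) ≠ .straight := Nat.find_spec hk₁ex
  have hk₁F : k₁ ≤ ω.2.firstHitG := Nat.find_min' hk₁ex hNS
  have hk₁ : k₁ < n := by omega
  have hstr : ∀ i < k₁, arcKind (ω.2.sIn i) (ω.2.sOut i) = .straight := by
    intro i hi; by_contra hne; exact Nat.find_min hk₁ex hi hne
  obtain ⟨hrun, -⟩ := ω.2.initial_run hh hk₁ hstr
  obtain ⟨hfk, hWk⟩ := hrun k₁ le_rfl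
  have hp₁W : ω.2.UsesSide (w.1 + k₁, w.2) .W := ⟨k₁, hk₁, hfk, Or.inl hWk⟩
  have hZrow : (ω.2.fc (n - 1)).2 = r.2 := by rcases hlast with ⟨-, -, e⟩ | ⟨-, -, e⟩ <;> rw [e]
  obtain ⟨τ1, hPτ⟩ : ∃ τ1 : ℤ, P (τ1, w.2) := by
    by_cases hpE : ω.2.UsesSide (w.1 + k₁, w.2) .E
    · obtain ⟨M, hWall, -, hend⟩ := ω.2.chain_E hX' hpE
      rcases hend with ⟨hM1, hnot⟩ | ⟨-, hs0⟩ | ⟨hZ, -⟩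
      · obtain ⟨i', hi', hfc', hsv', -, -, -, hk'⟩ := ω.2.isolated_of_usesSide_not_opp (hWall M hM1 le_rfl) hnot
        refine ⟨w.1 + k₁ + M, ?_⟩
        have := hPiso i' hi' hsv' hk'; rw [hfc'] at this; exact this
      · exact absurd hs0 h0E
      · have := congrArg Prod.snd hZ; rw [hZrow] at this; simp only at this; omega
    · obtain ⟨i', hi', hfc', hsv', -, -, -, hk'⟩ := ω.2.isolated_of_usesSide_not_opp hp₁W hpE
      refine ⟨w.1 + k₁, ?_⟩
      have := hPiso i' hi' hsv' hk'; rw [hfc'] at this; exact this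
  ---------------------------------------------------------------- a seventh isolated turn in `r`'s row is impossible
  have hne_of_row : ∀ f g : Face, f.2 ≠ g.2 → f ≠ g := fun f g hfg e => hfg (by rw [e])
  have hseventh : ∀ g : Face, P g → g.2 = r.2 → g = r := by
    intro g hg hg2
    by_contra hgr
    have hT : ∀ x ∈ ({ω.2.fc i₀, ω.2.fc i₁, ω.2.fc j₀, ω.2.fc j₁, r, ((τ1 : ℤ), w.2), g} : Finset Face), P x := by
      intro x hx
      simp only [Finset.mem_insert, Finset.mem_singleton] at hx
      rcases hx with rfl | rfl | rfl | rfl | rfl | rfl | rfl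
      · exact hPt₀
      · exact hPt₁
      · exact hPb₀
      · exact hPb₁
      · exact hPr
      · exact hPτ
      · exact hg
    have hcard : ({ω.2.fc i₀, ω.2.fc i₁, ω.2.fc j₀, ω.2.fc j₁, r, ((τ1 : ℤ), w.2), g} : Finset Face).card = 7 := by
      have n01 := hfne
      have n02 := hne_of_row (ω.2.fc i₀) (ω.2.fc j₀) (by rw [hrow₀, hrow₀']; omega)
      have n03 := hne_of_row (ω.2.fc i₀) (ω.2.fc j₁) (by rw [hrow₀, hrow₁']; omega)
      have n04 := hne_of_row (ω.2.fc i₀) r (by rw [hrow₀]; omega)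
      have n05 := hne_of_row (ω.2.fc i₀) (τ1, w.2) (by rw [hrow₀]; simp only; omega)
      have n06 := hne_of_row (ω.2.fc i₀) g (by rw [hrow₀, hg2]; omega)
      have n12 := hne_of_row (ω.2.fc i₁) (ω.2.fc j₀) (by rw [hrow₁, hrow₀']; omega)
      have n13 := hne_of_row (ω.2.fc i₁) (ω.2.fc j₁) (by rw [hrow₁, hrow₁']; omega)
      have n14 := hne_of_row (ω.2.fc i₁) r (by rw [hrow₁]; omega)
      have n15 := hne_of_row (ω.2.fc i₁) (τ1, w.2) (by rw [hrow₁]; simp only; omega)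
      have n16 := hne_of_row (ω.2.fc i₁) g (by rw [hrow₁, hg2]; omega)
      have n23 := hfne'
      have n24 := hne_of_row (ω.2.fc j₀) r (by rw [hrow₀']; omega)
      have n25 := hne_of_row (ω.2.fc j₀) (τ1, w.2) (by rw [hrow₀']; simp only; omega)
      have n26 := hne_of_row (ω.2.fc j₀) g (by rw [hrow₀', hg2]; omega)
      have n34 := hne_of_row (ω.2.fc j₁) r (by rw [hrow₁']; omega)
      have n35 := hne_of_row (ω.2.fc j₁) (τ1, w.2) (by rw [hrow₁']; simp only; omega)
      have n36 := hne_of_row (ω.2.fc j₁) g (by rw [hrow₁', hg2]; omega)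
      have n45 := hne_of_row r (τ1, w.2) (by simp only; omega)
      have n46 : r ≠ g := fun e => hgr e.symm
      have n56 := hne_of_row (τ1, w.2) g (by rw [hg2]; simp only; omega)
      rw [Finset.card_insert_of_notMem (by simp only [Finset.mem_insert, Finset.mem_singleton, not_or]; exact ⟨n01, n02, n03, n04, n05, n06⟩),
        Finset.card_insert_of_notMem (by simp only [Finset.mem_insert, Finset.mem_singleton, not_or]; exact ⟨n12, n13, n14, n15, n16⟩),
        Finset.card_insert_of_notMem (by simp only [Finset.mem_insert, Finset.mem_singleton, not_or]; exact ⟨n23, n24, n25, n26⟩),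
        Finset.card_insert_of_notMem (by simp only [Finset.mem_insert, Finset.mem_singleton, not_or]; exact ⟨n34, n35, n36⟩),
        Finset.card_insert_of_notMem (by simp only [Finset.mem_insert, Finset.mem_singleton, not_or]; exact ⟨n45, n46⟩),
        Finset.card_insert_of_notMem (by simp only [Finset.mem_singleton]; exact n56), Finset.card_singleton]
    have := hle6 _ hT
    omega
  ---------------------------------------------------------------- the horizontal chain of `r` along its row ends at such a seventh turn
  rcases hrEW with hrE | hrW
  · obtain ⟨M, hWall, -, hend⟩ := ω.2.chain_E hX' hrE
    rcases hend with ⟨hM1, hnot⟩ | ⟨hA0, hs0⟩ | ⟨hZ, hsZ⟩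
    · obtain ⟨i', hi', hfc', hsv', -, -, -, hk'⟩ := ω.2.isolated_of_usesSide_not_opp (hWall M hM1 le_rfl) hnot
      have hP' : P (r.1 + M, r.2) := by rw [← hfc']; exact hPiso i' hi' hsv' hk'
      have := congrArg Prod.fst (hseventh _ hP' rfl); simp only at this; omega
    · exact absurd hs0 h0E
    · rcases hlast with ⟨-, hsW, -⟩ | ⟨-, -, hfcZ⟩
      · rw [hsW] at hsZ; exact absurd hsZ (by decide)
      · rw [hfcZ] at hZ; have := congrArg Prod.fst hZ; simp only at this; omega
  · obtain ⟨M, hEall, -, hend⟩ := ω.2.chain_W hX hrW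
    rcases hend with ⟨hM1, hnot⟩ | ⟨hA0, -⟩ | ⟨hZ, hsZ⟩
    · obtain ⟨i', hi', hfc', hsv', -, -, -, hk'⟩ := ω.2.isolated_of_usesSide_not_opp (hEall M hM1 le_rfl) hnot
      have hP' : P (r.1 - M, r.2) := by rw [← hfc']; exact hPiso i' hi' hsv' hk'
      have := congrArg Prod.fst (hseventh _ hP' rfl); simp only at this; omega
    · rw [h0w] at hA0; have := congrArg Prod.snd hA0; simp only at this; omega
    · rcases hlast with ⟨-, -, hfcZ⟩ | ⟨-, hsE, -⟩
      · rw [hfcZ] at hZ; have := congrArg Prod.fst hZ; simp only at this; omega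
      · rw [hsE] at hsZ; exact absurd hsZ (by decide)

/-- ★★ **Hence the first arc in `r` uses the `S` side of `r` and not its `N` side**: the free fourth side of `r` — the slot of the class-`B2b` member obtained
by extending the walk through `r` — is `N`. [cite: GlazmanManolescu2019, §1, Fig. 1 and eq. (1); Remark 2.2] [cite: Glazman2015WeightedSAW, Lemma 3.1 (proof, pp. 6–7)] -/
theorem usesSide_S_of_cost_seven_vert_above (hh : holeFaceW w ∉ D) (hr : RootedFace D (w.side .W) r) (h : ω.IsB2a)
    (hA : ω.AJ hr h (toC (midPt (w.side .W))) ≠ 0) (hc : cost (slotOfSide ω.1) ω.2.mids = 7) (hz : ω.1 = .E ∨ ω.1 = .W)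
    (hNS : arcKind (ω.2.sIn ω.2.firstHitG) (ω.2.sOut ω.2.firstHitG) ≠ .straight) (habove : w.2 < r.2) :
    (ω.2.sIn ω.2.firstHitG = .S ∨ ω.2.sOut ω.2.firstHitG = .S) ∧ ω.2.sIn ω.2.firstHitG ≠ .N ∧ ω.2.sOut ω.2.firstHitG ≠ .N := by
  have htop := top_row_of_cost_seven_vert_above hh hr h hA hc hz hNS habove
  have hF := ω.fh_lt h
  have hfcF := (fc_fh ω hr h).1
  obtain ⟨hn1, hn2⟩ := forall_top_ne_N hh hr h htop habove _ hF (by rw [hfcF])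
  have hne := ω.2.sIn_ne_sOut hF
  refine ⟨?_, hn1, hn2⟩
  revert hNS hne hn1 hn2
  cases ω.2.sIn ω.2.firstHitG <;> cases ω.2.sOut ω.2.firstHitG <;> decide

end ΩG

end Literature.Probability.RandomPlanarGeometry.SAW.YangBaxter
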